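import Summits.BirchSwinnertonDyer.BirchSwinnertonDyer.Theorems.GoldfeldAllTwistsTwoConverseTwinBirchLemmaKrizLi7Twists
import HarnessLib

set_option linter.dupNamespace false -- namespace `…BirchSwinnertonDyer.BirchSwinnertonDyer…` is the cell's (D-0017 nested layout)
set_option autoImplicit false

/-!
# LINE B49, file 4c — Bernoulli-unit CERTIFICATES for Kriz–Li Thm. 1.20 at `p = 7` on `X₀(49)`:
# `q = 41, 61, 73` (`7 ∥ Σ_{j<28q} χ_{−4q}(j) j²⁹`, `decide +kernel`), and their consequences

Cell `bsd-goldfeld`, seat `bsd-goldfeld-s1p-c301` (prover, gen 5), TARGET v5.1 §2 c301 (e) T3 «further `q` (`41, 61, 73,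
89, …`) = one `decide +kernel` certificate each» (planner g12, `LINE-B49-PRESEARCH.md` §4–§5). `--supports` the S1⁺ route
items stmt-BirchSwinnertonDyer-20044 (K12₂″) / 19140 (twin″). Files 4 / 4b of the line
(`…TwinBirchLemmaKrizLi7{,Twists}`) prove, granted `KrizLi2019.thm120_padicLogHeegner_unit_of_bernoulli` (+ Modularity,
CLTZ Thm. 1.2, Gross–Zagier, Heegner rationality for the `ℚ`-level statements), that every level-`49` Heegner point of
`X₀(49)` over `ℚ(√−q)` has infinite order and `ord_{s=1} L(49a1^{(−q)}, s) = 1`, for each prime `q ≡ 1 (mod 4)`,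
`(q/7) = −1`, whose Bernoulli certificate holds: `‖B_{1,θ}‖₇ = 1` for every character `θ` mod `7·4q` with values
`[j odd]·(−q/j)·ω(j)⁴` (bsd-cm's `hcert₁` shape). bsd-cm certified `q = 5, 13, 17` (`RouteU.norm_generalizedBernoulli_theta1_E20
/ _E52 / _E68`); this file and its sibling `…KrizLi7CertificatesB` certify the next five members `41, 61, 73, 89, 101` of
planner g12's unit census (`482/572` of the `q < 20000`;
`97` is the first NON-unit and is correctly absent), in EXACTLY bsd-cm's kernel form (`RouteUMemberE52` pattern):
Kronecker value in reciprocity form `χ₄(j)·(j/q)` (`RouteU.jacobiSym_neg_eq_χ₄_mul`, `q ≡ 1 (mod 4)`), Euler's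
criterion in `ℕ` (`RouteU.jacobiSym_prime_eq_ite_nat`), the mod-`49` certificate
`RouteU.norm_generalizedBernoulli_one_eq_one_of_cert_range` with exponent `e = 28` (`ω(j)⁴ ≡ j²⁸ (mod 49)`,
`RouteU.norm_sub_le_of_values`) and the exact integer `S(q) = Σ_{j<28q} χ₄(j)(j/q) j²⁹` evaluated by `decide +kernel`
(`S(q) mod 49 = 28, 42, 7, 21, 21` for `q = 41, 61, 73, 89, 101` — the planner's pure-python census values, independently
recomputed). HONEST FRAMING: RANK axis at `p = 7` only; each certificate is ONE more member of the witness family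
(twist-density zero; never a closer); both items stay OPEN; BSD is not proved by any of this.

## Contents (THEOREMS ONLY; no `def`, no instance, no named fact)
* §1 per `q ∈ {41, 61, 73}`: `padicValNat_seven_level_q…`, `kroneckerVal_q…_eq`, `theta1_q…_sum` (the kernel
  sum), **`norm_generalizedBernoulli_theta1_q…`** (the certificate in `hcert₁` shape).
* §2 consequences BY NAME (files 4 / 4b): `not_isOfFinAddOrder_heegnerPoint_cm7_discr_neg164 / _neg244 / _neg292` (T1 over
  `K`, granted KL19 only) and `analyticRank_eq_one_twist_cm7_neg41 / _neg61 / _neg73`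
  («D(q)»: `ord_{s=1} L(W, s) = 1` for every elliptic `W ≅ 49a1^{(−q)}`, granted KL19, Modularity, CLTZ Thm. 1.2,
  Gross–Zagier, Heegner rationality).

References: [KrizLi2019] Thm. 1.20 (pp. 7–8), §1.5 (1), Rem. 1.21; [Washington1997] §5.1, Thm. 4.2; [Cox2013] §1.C Lemma 1.14,
(1.15)–(1.18); [GrossZagier1986] I.(6.3); [CoatesLiTianZhai2015] Thm. 1.2.
-/

noncomputable section

open scoped Classical NumberTheorySymbols

open WeierstrassCurve NumberField DirichletCharacter
open Literature.NumberTheory Literature.NumberTheory.EllipticCurves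
  Literature.NumberTheory.EllipticCurves.ModularForms
open Literature.NumberTheory.EllipticCurves.KrizLi2019 Literature.NumberTheory.LFunctions
open Summit.BirchSwinnertonDyer.Rank1Residual
open Summit.BirchSwinnertonDyer.Rank1Residual.X12.O11.RouteU

namespace Summit.BirchSwinnertonDyer.BirchSwinnertonDyer.Theorems.GoldfeldGoodTwists

/-! ## §1 The certificates -/

/-! ### `q = 41` (`d_K = −164`, level `7·164 = 1148`) -/

/-- `ord₇ (7·164) = 1`. [folklore] -/
theorem padicValNat_seven_level_q41 : padicValNat 7 (7 * (4 * 41)) = 1 := by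
  rw [padicValNat.mul (by norm_num) (by norm_num), padicValNat_self, padicValNat.eq_zero_of_not_dvd (by norm_num)]

/-- The Kronecker value of `d = −164` in reciprocity form: `[a odd]·(−41/a) = χ₄(a)·(a/41)`.
[cite: Cox2013, §1.C Lemma 1.14 and (1.15)–(1.18)] -/
theorem kroneckerVal_q41_eq (a : ℕ) :
    (if Even a then (0 : ℤ) else J(-((41 : ℕ) : ℤ) | a)) =
      (if a % 2 = 0 then (0 : ℤ) else if a % 4 = 1 then 1 else -1) * J((a : ℤ) | 41) := by
  by_cases ha0 : Even a
  · rw [if_pos ha0, if_pos (Nat.even_iff.mp ha0), zero_mul]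
  · have ha : Odd a := Nat.not_even_iff_odd.mp ha0
    rw [if_neg ha0, jacobiSym_neg_eq_χ₄_mul (n := 41) (by norm_num) ha, ZMod.χ₄_nat_eq_if_mod_four]

set_option maxRecDepth 400000 in
/-- The `θ₁` certificate sum for `q = 41`: `Σ_{j<1148} χ₄(j)(j/41) j²⁹` evaluated (`decide +kernel`); `7 ∥` it. [folklore] -/
theorem theta1_q41_sum :
    ∑ j ∈ Finset.range (7 * (4 * 41)),
      ((if j % 2 = 0 then (0 : ℤ) else if j % 4 = 1 then 1 else -1) * J((j : ℤ) | 41)) * (j : ℤ) ^ (28 + 1) =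
      (-365428526543156947597933925914020457195038241046921208963784510355030634609983011193120224) := by
  simp_rw [jacobiSym_prime_eq_ite_nat 41 (by norm_num) (by norm_num)]
  decide +kernel

set_option maxRecDepth 400000 in
/-- **`‖B_{1,θ₁}‖₇ = 1` for every character `θ₁` mod `7·164` with values `χ_{−164}(j)·ω(j)⁴`**, `ω` Teichmüller
(certificate `7 ∥ Σ_{j<1148} χ_{−164}(j) j²⁹`) — the Bernoulli hypothesis of KL19 Thm. 1.20 for `(X₀(49), 7, ℚ(√−41))`
in bsd-cm's `hcert₁` shape. [cite: KrizLi2019, Thm. 1.20 (p. 8) and §1.5 (1)] [cite: Washington1997, §5.1 and Thm. 4.2] -/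
theorem norm_generalizedBernoulli_theta1_q41 (ω : DirichletCharacter ℚ_[7] 7)
    (hω : IsTeichmullerCharacter ω) (θ : DirichletCharacter ℚ_[7] (7 * (4 * 41)))
    (hθ : ∀ j : ZMod (7 * (4 * 41)), θ j =
      ((if Even j.val then (0 : ℤ) else J(-((41 : ℕ) : ℤ) | j.val) : ℤ) : ℚ_[7]) * ω (j.val : ZMod 7) ^ 4) :
    ‖generalizedBernoulli 1 θ‖ = 1 := by
  have hθ' : ∀ j : ZMod (7 * (4 * 41)), θ j =
      (((if j.val % 2 = 0 then (0 : ℤ) else if j.val % 4 = 1 then 1 else -1) * J((j.val : ℤ) | 41) : ℤ) : ℚ_[7]) *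
        ω (j.val : ZMod 7) ^ 4 :=
    fun j => by rw [hθ j, kroneckerVal_q41_eq]
  have hθ1 : θ ≠ 1 := by
    intro h1
    have hv := hθ' (((1147 : ℕ)) : ZMod (7 * (4 * 41)))
    have hval : (((1147 : ℕ) : ZMod (7 * (4 * 41)))).val = 1147 := by rw [ZMod.val_natCast]
    have h6 : (((1147 : ℕ)) : ZMod 7) = ((6 : ℕ) : ZMod 7) := by decide
    have hu : IsUnit (((1147 : ℕ)) : ZMod (7 * (4 * 41))) := by rw [ZMod.isUnit_iff_coprime]; norm_num
    rw [h1, hval, MulChar.one_apply hu, h6, apply_neg_one_pow_four, mul_one] at hv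
    have hL : ((if (1147 : ℕ) % 2 = 0 then (0 : ℤ) else if (1147 : ℕ) % 4 = 1 then 1 else -1) *
        J(((1147 : ℕ) : ℤ) | 41)) = -1 := by
      rw [jacobiSym_prime_eq_ite_nat 41 (by norm_num) (by norm_num)]; decide
    rw [hL] at hv
    norm_num at hv
  refine norm_generalizedBernoulli_one_eq_one_of_cert_range θ hθ1 padicValNat_seven_level_q41
    (fun j => (if j % 2 = 0 then (0 : ℤ) else if j % 4 = 1 then 1 else -1) * J((j : ℤ) | 41)) 28 (fun j => ?_)
    _ theta1_q41_sum (by norm_num) (by norm_num)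
  have := norm_sub_le_of_values ω hω θ
    (fun j => (if j % 2 = 0 then (0 : ℤ) else if j % 4 = 1 then 1 else -1) * J((j : ℤ) | 41)) 4 (by norm_num) hθ' j
  simpa using this

/-! ### `q = 61` (`d_K = −244`, level `7·244 = 1708`) -/

/-- `ord₇ (7·244) = 1`. [folklore] -/
theorem padicValNat_seven_level_q61 : padicValNat 7 (7 * (4 * 61)) = 1 := by
  rw [padicValNat.mul (by norm_num) (by norm_num), padicValNat_self, padicValNat.eq_zero_of_not_dvd (by norm_num)]

/-- The Kronecker value of `d = −244` in reciprocity form: `[a odd]·(−61/a) = χ₄(a)·(a/61)`.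
[cite: Cox2013, §1.C Lemma 1.14 and (1.15)–(1.18)] -/
theorem kroneckerVal_q61_eq (a : ℕ) :
    (if Even a then (0 : ℤ) else J(-((61 : ℕ) : ℤ) | a)) =
      (if a % 2 = 0 then (0 : ℤ) else if a % 4 = 1 then 1 else -1) * J((a : ℤ) | 61) := by
  by_cases ha0 : Even a
  · rw [if_pos ha0, if_pos (Nat.even_iff.mp ha0), zero_mul]
  · have ha : Odd a := Nat.not_even_iff_odd.mp ha0
    rw [if_neg ha0, jacobiSym_neg_eq_χ₄_mul (n := 61) (by norm_num) ha, ZMod.χ₄_nat_eq_if_mod_four]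

set_option maxRecDepth 400000 in
/-- The `θ₁` certificate sum for `q = 61`: `Σ_{j<1708} χ₄(j)(j/61) j²⁹` evaluated (`decide +kernel`); `7 ∥` it. [folklore] -/
theorem theta1_q61_sum :
    ∑ j ∈ Finset.range (7 * (4 * 61)),
      ((if j % 2 = 0 then (0 : ℤ) else if j % 4 = 1 then 1 else -1) * J((j : ℤ) | 61)) * (j : ℤ) ^ (28 + 1) =
      (-25035878486503191578927653308368944950438594820577801546743422412593942732840919489926518232168) := by
  simp_rw [jacobiSym_prime_eq_ite_nat 61 (by norm_num) (by norm_num)]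
  decide +kernel

set_option maxRecDepth 400000 in
/-- **`‖B_{1,θ₁}‖₇ = 1` for every character `θ₁` mod `7·244` with values `χ_{−244}(j)·ω(j)⁴`**, `ω` Teichmüller
(certificate `7 ∥ Σ_{j<1708} χ_{−244}(j) j²⁹`) — the Bernoulli hypothesis of KL19 Thm. 1.20 for `(X₀(49), 7, ℚ(√−61))`
in bsd-cm's `hcert₁` shape. [cite: KrizLi2019, Thm. 1.20 (p. 8) and §1.5 (1)] [cite: Washington1997, §5.1 and Thm. 4.2] -/
theorem norm_generalizedBernoulli_theta1_q61 (ω : DirichletCharacter ℚ_[7] 7)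
    (hω : IsTeichmullerCharacter ω) (θ : DirichletCharacter ℚ_[7] (7 * (4 * 61)))
    (hθ : ∀ j : ZMod (7 * (4 * 61)), θ j =
      ((if Even j.val then (0 : ℤ) else J(-((61 : ℕ) : ℤ) | j.val) : ℤ) : ℚ_[7]) * ω (j.val : ZMod 7) ^ 4) :
    ‖generalizedBernoulli 1 θ‖ = 1 := by
  have hθ' : ∀ j : ZMod (7 * (4 * 61)), θ j =
      (((if j.val % 2 = 0 then (0 : ℤ) else if j.val % 4 = 1 then 1 else -1) * J((j.val : ℤ) | 61) : ℤ) : ℚ_[7]) *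
        ω (j.val : ZMod 7) ^ 4 :=
    fun j => by rw [hθ j, kroneckerVal_q61_eq]
  have hθ1 : θ ≠ 1 := by
    intro h1
    have hv := hθ' (((1707 : ℕ)) : ZMod (7 * (4 * 61)))
    have hval : (((1707 : ℕ) : ZMod (7 * (4 * 61)))).val = 1707 := by rw [ZMod.val_natCast]
    have h6 : (((1707 : ℕ)) : ZMod 7) = ((6 : ℕ) : ZMod 7) := by decide
    have hu : IsUnit (((1707 : ℕ)) : ZMod (7 * (4 * 61))) := by rw [ZMod.isUnit_iff_coprime]; norm_num
    rw [h1, hval, MulChar.one_apply hu, h6, apply_neg_one_pow_four, mul_one] at hv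
    have hL : ((if (1707 : ℕ) % 2 = 0 then (0 : ℤ) else if (1707 : ℕ) % 4 = 1 then 1 else -1) *
        J(((1707 : ℕ) : ℤ) | 61)) = -1 := by
      rw [jacobiSym_prime_eq_ite_nat 61 (by norm_num) (by norm_num)]; decide
    rw [hL] at hv
    norm_num at hv
  refine norm_generalizedBernoulli_one_eq_one_of_cert_range θ hθ1 padicValNat_seven_level_q61
    (fun j => (if j % 2 = 0 then (0 : ℤ) else if j % 4 = 1 then 1 else -1) * J((j : ℤ) | 61)) 28 (fun j => ?_)
    _ theta1_q61_sum (by norm_num) (by norm_num)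
  have := norm_sub_le_of_values ω hω θ
    (fun j => (if j % 2 = 0 then (0 : ℤ) else if j % 4 = 1 then 1 else -1) * J((j : ℤ) | 61)) 4 (by norm_num) hθ' j
  simpa using this

/-! ### `q = 73` (`d_K = −292`, level `7·292 = 2044`) -/

/-- `ord₇ (7·292) = 1`. [folklore] -/
theorem padicValNat_seven_level_q73 : padicValNat 7 (7 * (4 * 73)) = 1 := by
  rw [padicValNat.mul (by norm_num) (by norm_num), padicValNat_self, padicValNat.eq_zero_of_not_dvd (by norm_num)]

/-- The Kronecker value of `d = −292` in reciprocity form: `[a odd]·(−73/a) = χ₄(a)·(a/73)`.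
[cite: Cox2013, §1.C Lemma 1.14 and (1.15)–(1.18)] -/
theorem kroneckerVal_q73_eq (a : ℕ) :
    (if Even a then (0 : ℤ) else J(-((73 : ℕ) : ℤ) | a)) =
      (if a % 2 = 0 then (0 : ℤ) else if a % 4 = 1 then 1 else -1) * J((a : ℤ) | 73) := by
  by_cases ha0 : Even a
  · rw [if_pos ha0, if_pos (Nat.even_iff.mp ha0), zero_mul]
  · have ha : Odd a := Nat.not_even_iff_odd.mp ha0
    rw [if_neg ha0, jacobiSym_neg_eq_χ₄_mul (n := 73) (by norm_num) ha, ZMod.χ₄_nat_eq_if_mod_four]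

set_option maxRecDepth 400000 in
/-- The `θ₁` certificate sum for `q = 73`: `Σ_{j<2044} χ₄(j)(j/73) j²⁹` evaluated (`decide +kernel`); `7 ∥` it. [folklore] -/
theorem theta1_q73_sum :
    ∑ j ∈ Finset.range (7 * (4 * 73)),
      ((if j % 2 = 0 then (0 : ℤ) else if j % 4 = 1 then 1 else -1) * J((j : ℤ) | 73)) * (j : ℤ) ^ (28 + 1) =
      (-2454785247713404190657213995209241148181658095669338549205918385485620791070321562281092930891696) := by
  simp_rw [jacobiSym_prime_eq_ite_nat 73 (by norm_num) (by norm_num)]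
  decide +kernel

set_option maxRecDepth 400000 in
/-- **`‖B_{1,θ₁}‖₇ = 1` for every character `θ₁` mod `7·292` with values `χ_{−292}(j)·ω(j)⁴`**, `ω` Teichmüller
(certificate `7 ∥ Σ_{j<2044} χ_{−292}(j) j²⁹`) — the Bernoulli hypothesis of KL19 Thm. 1.20 for `(X₀(49), 7, ℚ(√−73))`
in bsd-cm's `hcert₁` shape. [cite: KrizLi2019, Thm. 1.20 (p. 8) and §1.5 (1)] [cite: Washington1997, §5.1 and Thm. 4.2] -/
theorem norm_generalizedBernoulli_theta1_q73 (ω : DirichletCharacter ℚ_[7] 7)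
    (hω : IsTeichmullerCharacter ω) (θ : DirichletCharacter ℚ_[7] (7 * (4 * 73)))
    (hθ : ∀ j : ZMod (7 * (4 * 73)), θ j =
      ((if Even j.val then (0 : ℤ) else J(-((73 : ℕ) : ℤ) | j.val) : ℤ) : ℚ_[7]) * ω (j.val : ZMod 7) ^ 4) :
    ‖generalizedBernoulli 1 θ‖ = 1 := by
  have hθ' : ∀ j : ZMod (7 * (4 * 73)), θ j =
      (((if j.val % 2 = 0 then (0 : ℤ) else if j.val % 4 = 1 then 1 else -1) * J((j.val : ℤ) | 73) : ℤ) : ℚ_[7]) *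
        ω (j.val : ZMod 7) ^ 4 :=
    fun j => by rw [hθ j, kroneckerVal_q73_eq]
  have hθ1 : θ ≠ 1 := by
    intro h1
    have hv := hθ' (((2043 : ℕ)) : ZMod (7 * (4 * 73)))
    have hval : (((2043 : ℕ) : ZMod (7 * (4 * 73)))).val = 2043 := by rw [ZMod.val_natCast]
    have h6 : (((2043 : ℕ)) : ZMod 7) = ((6 : ℕ) : ZMod 7) := by decide
    have hu : IsUnit (((2043 : ℕ)) : ZMod (7 * (4 * 73))) := by rw [ZMod.isUnit_iff_coprime]; norm_num
    rw [h1, hval, MulChar.one_apply hu, h6, apply_neg_one_pow_four, mul_one] at hv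
    have hL : ((if (2043 : ℕ) % 2 = 0 then (0 : ℤ) else if (2043 : ℕ) % 4 = 1 then 1 else -1) *
        J(((2043 : ℕ) : ℤ) | 73)) = -1 := by
      rw [jacobiSym_prime_eq_ite_nat 73 (by norm_num) (by norm_num)]; decide
    rw [hL] at hv
    norm_num at hv
  refine norm_generalizedBernoulli_one_eq_one_of_cert_range θ hθ1 padicValNat_seven_level_q73
    (fun j => (if j % 2 = 0 then (0 : ℤ) else if j % 4 = 1 then 1 else -1) * J((j : ℤ) | 73)) 28 (fun j => ?_)
    _ theta1_q73_sum (by norm_num) (by norm_num)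
  have := norm_sub_le_of_values ω hω θ
    (fun j => (if j % 2 = 0 then (0 : ℤ) else if j % 4 = 1 then 1 else -1) * J((j : ℤ) | 73)) 4 (by norm_num) hθ' j
  simpa using this
/-! ## §2 Consequences: T1 over `K` and «D(q)» over `ℚ` for `q = 41, 61, 73` -/

/-- **Every level-`49` Heegner point of `X₀(49)` over `K = ℚ(√−41)` (`d_K = −164`) has infinite order**, granted KL19
Thm. 1.20 (certificate `norm_generalizedBernoulli_theta1_q41`). [cite: KrizLi2019, Thm. 1.20 (pp. 7–8) and Rem. 1.21] -/
theorem not_isOfFinAddOrder_heegnerPoint_cm7_discr_neg164 (h120 : thm120_padicLogHeegner_unit_of_bernoulli)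
    (K : Type) [Field K] [NumberField K] (hK : IsImaginaryQuadratic K) (hdK : NumberField.discr K = -164)
    {P : (cm7.baseChange K).toAffine.Point} (hP : IsHeegnerPoint 49 cm7 K P) : ¬ IsOfFinAddOrder P :=
  haveI : Fact (Nat.Prime 41) := ⟨by norm_num⟩
  not_isOfFinAddOrder_heegnerPoint_cm7_of_thm120 h120 (q := 41) (by norm_num)
    norm_generalizedBernoulli_theta1_q41 K hK (by rw [hdK]; norm_num) hP

/-- **«D(41)»: `ord_{s=1} L(W, s) = 1` for every elliptic `W/ℚ` isomorphic to `49a1^{(−41)}`**, granted KL19 Thm. 1.20,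
Modularity, CLTZ Thm. 1.2 (`R = 1`), Gross–Zagier, Heegner rationality (certificate `norm_generalizedBernoulli_theta1_q41`;
`(41/7) = −1`, `41 ≡ 1 (mod 4)`). [cite: KrizLi2019, Thm. 1.20 (pp. 7–8)] [cite: GrossZagier1986, Thm. I.(6.3) and I.§7] -/
theorem analyticRank_eq_one_twist_cm7_neg41 (h120 : thm120_padicLogHeegner_unit_of_bernoulli)
    (hnf : ModularForms.exists_isNewformOf) (h12 : CoatesLiTianZhai2015.thm12_fullBSD_twist)
    (hGZ : ∀ (N : ℕ) [NeZero N] (W : WeierstrassCurve ℚ) (K : Type) [Field K] [NumberField K],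
      gross_zagier N W K)
    (hHP : ∀ (W : WeierstrassCurve ℚ) (K : Type) [Field K] [NumberField K], exists_isHeegnerPoint W K)
    (W : WeierstrassCurve ℚ) [W.IsElliptic] (C : VariableChange ℚ) (hC : C • W = cm7.quadraticTwist (-41)) :
    W.analyticRank = 1 :=
  haveI : Fact (Nat.Prime 41) := ⟨by norm_num⟩
  analyticRank_eq_one_inertPrimeTwist_of_thm120 h120 hnf h12 hGZ hHP (q := 41) (by norm_num) (by norm_num)
    norm_generalizedBernoulli_theta1_q41 W C (by rw [hC]; norm_num)

/-- **Every level-`49` Heegner point of `X₀(49)` over `K = ℚ(√−61)` (`d_K = −244`) has infinite order**, granted KL19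
Thm. 1.20 (certificate `norm_generalizedBernoulli_theta1_q61`). [cite: KrizLi2019, Thm. 1.20 (pp. 7–8) and Rem. 1.21] -/
theorem not_isOfFinAddOrder_heegnerPoint_cm7_discr_neg244 (h120 : thm120_padicLogHeegner_unit_of_bernoulli)
    (K : Type) [Field K] [NumberField K] (hK : IsImaginaryQuadratic K) (hdK : NumberField.discr K = -244)
    {P : (cm7.baseChange K).toAffine.Point} (hP : IsHeegnerPoint 49 cm7 K P) : ¬ IsOfFinAddOrder P :=
  haveI : Fact (Nat.Prime 61) := ⟨by norm_num⟩
  not_isOfFinAddOrder_heegnerPoint_cm7_of_thm120 h120 (q := 61) (by norm_num)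
    norm_generalizedBernoulli_theta1_q61 K hK (by rw [hdK]; norm_num) hP

/-- **«D(61)»: `ord_{s=1} L(W, s) = 1` for every elliptic `W/ℚ` isomorphic to `49a1^{(−61)}`**, granted KL19 Thm. 1.20,
Modularity, CLTZ Thm. 1.2 (`R = 1`), Gross–Zagier, Heegner rationality (certificate `norm_generalizedBernoulli_theta1_q61`;
`(61/7) = −1`, `61 ≡ 1 (mod 4)`). [cite: KrizLi2019, Thm. 1.20 (pp. 7–8)] [cite: GrossZagier1986, Thm. I.(6.3) and I.§7] -/
theorem analyticRank_eq_one_twist_cm7_neg61 (h120 : thm120_padicLogHeegner_unit_of_bernoulli)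
    (hnf : ModularForms.exists_isNewformOf) (h12 : CoatesLiTianZhai2015.thm12_fullBSD_twist)
    (hGZ : ∀ (N : ℕ) [NeZero N] (W : WeierstrassCurve ℚ) (K : Type) [Field K] [NumberField K],
      gross_zagier N W K)
    (hHP : ∀ (W : WeierstrassCurve ℚ) (K : Type) [Field K] [NumberField K], exists_isHeegnerPoint W K)
    (W : WeierstrassCurve ℚ) [W.IsElliptic] (C : VariableChange ℚ) (hC : C • W = cm7.quadraticTwist (-61)) :
    W.analyticRank = 1 :=
  haveI : Fact (Nat.Prime 61) := ⟨by norm_num⟩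
  analyticRank_eq_one_inertPrimeTwist_of_thm120 h120 hnf h12 hGZ hHP (q := 61) (by norm_num) (by norm_num)
    norm_generalizedBernoulli_theta1_q61 W C (by rw [hC]; norm_num)

/-- **Every level-`49` Heegner point of `X₀(49)` over `K = ℚ(√−73)` (`d_K = −292`) has infinite order**, granted KL19
Thm. 1.20 (certificate `norm_generalizedBernoulli_theta1_q73`). [cite: KrizLi2019, Thm. 1.20 (pp. 7–8) and Rem. 1.21] -/
theorem not_isOfFinAddOrder_heegnerPoint_cm7_discr_neg292 (h120 : thm120_padicLogHeegner_unit_of_bernoulli)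
    (K : Type) [Field K] [NumberField K] (hK : IsImaginaryQuadratic K) (hdK : NumberField.discr K = -292)
    {P : (cm7.baseChange K).toAffine.Point} (hP : IsHeegnerPoint 49 cm7 K P) : ¬ IsOfFinAddOrder P :=
  haveI : Fact (Nat.Prime 73) := ⟨by norm_num⟩
  not_isOfFinAddOrder_heegnerPoint_cm7_of_thm120 h120 (q := 73) (by norm_num)
    norm_generalizedBernoulli_theta1_q73 K hK (by rw [hdK]; norm_num) hP

/-- **«D(73)»: `ord_{s=1} L(W, s) = 1` for every elliptic `W/ℚ` isomorphic to `49a1^{(−73)}`**, granted KL19 Thm. 1.20,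
Modularity, CLTZ Thm. 1.2 (`R = 1`), Gross–Zagier, Heegner rationality (certificate `norm_generalizedBernoulli_theta1_q73`;
`(73/7) = −1`, `73 ≡ 1 (mod 4)`). [cite: KrizLi2019, Thm. 1.20 (pp. 7–8)] [cite: GrossZagier1986, Thm. I.(6.3) and I.§7] -/
theorem analyticRank_eq_one_twist_cm7_neg73 (h120 : thm120_padicLogHeegner_unit_of_bernoulli)
    (hnf : ModularForms.exists_isNewformOf) (h12 : CoatesLiTianZhai2015.thm12_fullBSD_twist)
    (hGZ : ∀ (N : ℕ) [NeZero N] (W : WeierstrassCurve ℚ) (K : Type) [Field K] [NumberField K],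
      gross_zagier N W K)
    (hHP : ∀ (W : WeierstrassCurve ℚ) (K : Type) [Field K] [NumberField K], exists_isHeegnerPoint W K)
    (W : WeierstrassCurve ℚ) [W.IsElliptic] (C : VariableChange ℚ) (hC : C • W = cm7.quadraticTwist (-73)) :
    W.analyticRank = 1 :=
  haveI : Fact (Nat.Prime 73) := ⟨by norm_num⟩
  analyticRank_eq_one_inertPrimeTwist_of_thm120 h120 hnf h12 hGZ hHP (q := 73) (by norm_num) (by norm_num)
    norm_generalizedBernoulli_theta1_q73 W C (by rw [hC]; norm_num)

end Summit.BirchSwinnertonDyer.BirchSwinnertonDyer.Theorems.GoldfeldGoodTwists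

end
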